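import Summits.HodgeConjecture.HodgeConjecture.Theorems.F0P3cStCharTSWeylHypWIF   -- ★ (LH2-p02 (g3)): generic §1 `orbitalIntegral_eq_integral_conjFamily_of_centralizer_eq`; brings ★ `OrbitalMeasureCanonicalAtPoint` (`IsCanonical.classOrbitalIntegral_mk_eq_orbitalIntegral'`, `eq_of_apply_compactCore_eq_one`), ★ `OrbitalMeasureCanonicalExistsCM` (`compactCore_centralizer_local_facts_of_isRegularElt`, `isRegularElt_of_fin_one`), ★ `CompactCoreCentralizerUnitary` (`exists_isHaarMeasure_compactCore_centralizer_prod_eq_one`), ★ `LocalTransfer` (`IsLocalGRegular`, `endoEmbLocal`, `isRegularElt_conj_iff`)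
import Summits.HodgeConjecture.HodgeConjecture.Theorems.F0P3cStCharTSUpTrCartanFields   -- ★ ROAD «UP-TR» (H3b) (LH4-p01 (g8)): `isClosed_cartan`, `centralizer_eq_cartan_of_isLocalGRegular` (`Z_H(t) = T` for `G`-regular `t ∈ T = Z_H(γ₀)`)
import HarnessLib

/-!
# F0 · P3c · line LH6 «StCharTS» — ROAD «UP-TR» (H3d) «ORBINT-H»: the CANONICAL orbital integral at a `G`-regular element of ANY Cartan subgroup `T = Z_H(γ₀)` of
# `H_v = U(Φ₂)(L⁺_v) × U(Φ₁)(L⁺_v)` is the fibre integral of the conjugation family over `H_v ⧸ T` against `νHv ∕ t_T`, `t_T` THE Haar measure of `T` with mass one on its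
# compact core (Rogawski 1990 §4.3 (4.3.1) p. 43, §12.5 pp. 182–183; Deitmar–Echterhoff Thm. 1.5.3)

Cell `pub/hodgecm-mathlib`, crux H413 = `stmt-HodgeConjecture-24833` (lane `--supports`, helper); seat F0P3a-p04 (g28); ROAD «UP-TR» (LEAD T14-21 2026-09-02T18:13:47Z, holder ∕ dealer
F0P3-p02 (g23), board `F0/P3/F0P3-p02/g23/ROAD-UP-TR.v1.F0P3p02g23.md`), brick (H3d) = the `H_v`-TWIN of ★ (E3) `F0P3cStCharTSWeylCartanOrbInt` (F0P3a-p05 (g22)).  THEOREMS ONLY;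
sorry-free; no definition ∕ instance ∕ notation ∕ named fact; ★-only imports; axioms TRIO.

WHY.  The in-house derivation of the `up` row's last printed clause `hUpTr` [Rogawski1990 §12.5 p. 183, L. 12.5.1] needs a Weyl integration formula ON `H_v` ((H5) WIF-H) whose
torus-side integrand is the CANONICAL orbital integral `classOrbitalIntegral mHv fH ⟦s⟧` of the (S-𝔑) block's letters (`hcanH : mHv.IsCanonical (IsLocalGRegular L v) νHv`, ★
`OrbitalMeasureFamily.IsCanonical`), while the generic WIF engine (★ `exists_radialMeasure_lintegral_conjFamily`, (E1)–(E2) twins) produces the FIBRE INTEGRAL `∫_{H_v ⧸ T} fH(Φ(q, s)) d(νHv ∕ t_T)`.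
This file identifies the two at every `G`-regular `s` of a Cartan subgroup `T = Z_H(γ₀)` of `H_v`, exactly as ★ (E3) does on `U(Φ₃)(L⁺_v)`:
* §1 **`forall_isLocalGRegular_exists_isHaarMeasure_compactCore_centralizer_eq_one`** — at every `G`-regular `γ_H ∈ H_v` the centraliser `Z_H(γ_H)` carries a Haar measure, inversion
  invariant, with mass `1` on its compact core: the `H_v`-analogue of ★ `forall_isRegularElt_exists_isHaarMeasure_compactCore_centralizer_local_eq_one` (it is the pointwise content of
  the proof of ★ `exists_isCanonical_H_local`, exported: `γ_H = (γ₂, γ₁)` `G`-regular ⇒ `γ₂` regular semisimple (★ `coe_endoEmbLocal`, ★ `charpoly_endoGL`), `γ₁ ∈ GL₁` always (★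
  `isRegularElt_of_fin_one`); ★ `compactCore_centralizer_local_facts_of_isRegularElt` on both factors; ★ `exists_isHaarMeasure_compactCore_centralizer_prod_eq_one`);
  **`exists_haar_cartanH_compactCore_eq_one`** — the same read on `T = Z_H(γ₀)` (twin of ★ (E3) §1).
* §2 **`classOrbitalIntegral_mk_eq_integral_conjFamily_of_centralizer_eq_H`** (any closed `T`, `t ∈ T` `G`-regular with `Z_H(t) = T` as the binder `hZt`) and
  **`classOrbitalIntegral_mk_eq_integral_conjFamily_cartanH`** (`T = Z_H(γ₀)`, `γ₀` `G`-regular, `hZt` discharged by ★ (H3b) `centralizer_eq_cartan_of_isLocalGRegular` — binder for binder the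
  twin of ★ (E3) §2) — for `mHv` canonical for the `G`-regular classes (`hcanH`), `t_T` as in §1, `t ∈ T` `G`-regular and `φ` measurable:
  **`classOrbitalIntegral mHv φ ⟦t⟧ = ∫_{H_v ⧸ T} φ(Φ(q, t)) d(νHv ∕ t_T)(q)`** (★ `IsCanonical.classOrbitalIntegral_mk_eq_orbitalIntegral'` with the canonical torus measure of `Z_H(t)`
  — `G`-regularity is a class function on `H_v` since `ι_v = endoEmbLocal` is a homomorphism (★ `isRegularElt_conj_iff`) —, which read on `T = Z_H(t)` IS `t_T` by Haar uniqueness under the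
  compact-core normalisation (★ `eq_of_apply_compactCore_eq_one`, ★ `image_compactCore`), then ★ generic `orbitalIntegral_eq_integral_conjFamily_of_centralizer_eq`).
CARRIER: `H_v` spelled out (road LETTERS §2); instance binders as ★ (E3) ∕ RUNG0 v5 (`[MeasurableSpace H_v] [BorelSpace H_v]`, the quotient σ-algebra families as binders — the block's
`letI := borel`).
HONEST LABEL: count-neutral dictionary brick of ROAD «UP-TR»; block consequents 11 → 10 → 9 only at the rider editions; organs 2 = 2; h413 registry untouched; closes no organ.  HC_CM is
proved only modulo the printed citations (2 remaining: hLiu418 = `stmt-HodgeConjecture-24832`, h413 = `stmt-HodgeConjecture-24833`) until rung 0 closes.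

## References
* [Rogawski1990] J. D. Rogawski, *Automorphic Representations of Unitary Groups in Three Variables*, Ann. of Math. Stud. 123 (1990), §4.3 (4.3.1) p. 43 (orbital integrals on `H` and
  `G` with compatible measures on `H_{γ′}`, `G_γ`), §1.7 p. 6 (normalisations), §12.5 pp. 182–183 (the Weyl integration formula; `α ↦ α^G` and Lemma 12.5.1).
* [DeitmarEchterhoff2014] A. Deitmar, S. Echterhoff, *Principles of Harmonic Analysis*, 2nd ed. (2014), Thm. 1.5.3 (invariant quotient measures).
* [HarishChandra1970] Harish-Chandra (notes by G. van Dijk), *Harmonic analysis on reductive p-adic groups*, LNM 162 (1970), Lemma 42.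
-/

set_option autoImplicit false
-- the mandated namespace has the single-problem summit's repeated segment (`HodgeConjecture.HodgeConjecture`)
set_option linter.dupNamespace false

noncomputable section

open MeasureTheory Measure Set Filter Topology Function NumberField IsDedekindDomain Matrix Polynomial
open Literature.MeasureTheory.Group
open Literature.NumberTheory.Automorphic Literature.NumberTheory.Automorphic.UnitaryGroup Literature.NumberTheory.Rogawski1990
open Summit.HodgeConjecture.HodgeConjecture.Cruxes.H413.F0P3cStCharTSWeylHypWIF
open Summit.HodgeConjecture.HodgeConjecture.Cruxes.H413.F0P3cStCharTSUpTrCartanFields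
open scoped ENNReal NNReal MatrixGroups Pointwise

namespace Summit.HodgeConjecture.HodgeConjecture.Cruxes.H413.F0P3cStCharTSUpTrOrbInt

section CMH

variable {L : Type} [Field L] [NumberField L] [IsCMField L] {v : HeightOneSpectrum (𝓞 ↥(maximalRealSubfield L))}

/-! ## §1 The normalised Haar measure of the centraliser of a `G`-regular element of `H_v`, and of a Cartan subgroup `T = Z_H(γ₀)` -/

/-- **At every `G`-regular `γ_H ∈ H_v = U(Φ₂)(L⁺_v) × U(Φ₁)(L⁺_v)` the centraliser `Z_H(γ_H)` carries a Haar measure, inversion invariant, with mass `1` on its compact core** — the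
`H_v`-analogue of ★ `forall_isRegularElt_exists_isHaarMeasure_compactCore_centralizer_local_eq_one` (the `ht` input of ★ `OrbitalMeasureFamily.exists_isCanonical`; the pointwise content
of the proof of ★ `exists_isCanonical_H_local`): `γ_H = (γ₂, γ₁)` `G`-regular ⇒ `γ₂` regular semisimple (a separable product has separable factors), `γ₁ ∈ GL₁` regular; ★
`compactCore_centralizer_local_facts_of_isRegularElt` on both factors and ★ `exists_isHaarMeasure_compactCore_centralizer_prod_eq_one`.
[cite: Rogawski1990, §4.3 (4.3.1) p. 43; §1.7 p. 6] [cite: DeitmarEchterhoff2014, Thm. 1.5.3] -/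
theorem forall_isLocalGRegular_exists_isHaarMeasure_compactCore_centralizer_eq_one
    [MeasurableSpace ((UnitaryGroup.cmDatum L 2 (Matrix.of fun i j : Fin 2 => if i.val + j.val + 1 = 2 then (1 : L) else 0)).Local v ×
      (UnitaryGroup.cmDatum L 1 (Matrix.of fun i j : Fin 1 => if i.val + j.val + 1 = 1 then (1 : L) else 0)).Local v)]
    [BorelSpace ((UnitaryGroup.cmDatum L 2 (Matrix.of fun i j : Fin 2 => if i.val + j.val + 1 = 2 then (1 : L) else 0)).Local v ×
      (UnitaryGroup.cmDatum L 1 (Matrix.of fun i j : Fin 1 => if i.val + j.val + 1 = 1 then (1 : L) else 0)).Local v)] :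
    ∀ γH : (UnitaryGroup.cmDatum L 2 (Matrix.of fun i j : Fin 2 => if i.val + j.val + 1 = 2 then (1 : L) else 0)).Local v ×
        (UnitaryGroup.cmDatum L 1 (Matrix.of fun i j : Fin 1 => if i.val + j.val + 1 = 1 then (1 : L) else 0)).Local v,
      IsLocalGRegular L v γH →
        ∃ t : Measure ↥(Subgroup.centralizer ({γH} : Set ((UnitaryGroup.cmDatum L 2 (Matrix.of fun i j : Fin 2 => if i.val + j.val + 1 = 2 then (1 : L) else 0)).Local v ×
            (UnitaryGroup.cmDatum L 1 (Matrix.of fun i j : Fin 1 => if i.val + j.val + 1 = 1 then (1 : L) else 0)).Local v))),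
          t.IsHaarMeasure ∧ t.IsInvInvariant ∧
            t (compactCore ↥(Subgroup.centralizer ({γH} : Set ((UnitaryGroup.cmDatum L 2 (Matrix.of fun i j : Fin 2 => if i.val + j.val + 1 = 2 then (1 : L) else 0)).Local v ×
              (UnitaryGroup.cmDatum L 1 (Matrix.of fun i j : Fin 1 => if i.val + j.val + 1 = 1 then (1 : L) else 0)).Local v)))) = 1 := by
  intro γH hγH
  have hΦ₂ := antidiagOne_map_transpose (IsCMField.complexConj L) 2
  have hΦ₁ := antidiagOne_map_transpose (IsCMField.complexConj L) 1
  have hΦ₂d : IsUnit (Matrix.of fun i j : Fin 2 => if i.val + j.val + 1 = 2 then (1 : L) else 0).det := isUnit_antidiagOne_det L 2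
  have hΦ₁d : IsUnit (Matrix.of fun i j : Fin 1 => if i.val + j.val + 1 = 1 then (1 : L) else 0).det := isUnit_antidiagOne_det L 1
  obtain ⟨γ₂, γ₁⟩ := γH
  -- `G`-regularity of `(γ₂, γ₁)` is regularity of `ι_v(γ₂, γ₁) = endoGL(γ₂, γ₁)` (★ `coe_endoEmbLocal`), whose characteristic polynomial is the product (★ `charpoly_endoGL`)
  have h3 : IsRegularElt ((endoEmbLocal L v (γ₂, γ₁)).val : GL (Fin 3) (UnitaryGroup.LocalRing L v)) := hγH
  rw [isRegularElt_iff, coe_endoEmbLocal, charpoly_endoGL] at h3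
  have h₂ : IsRegularElt (γ₂.val : GL (Fin 2) (UnitaryGroup.LocalRing L v)) := h3.of_mul_left
  have h₁ : IsRegularElt (γ₁.val : GL (Fin 1) (UnitaryGroup.LocalRing L v)) := isRegularElt_of_fin_one _
  -- pin the factor carriers to the `cmDatum` spellings (so every instance is the letter's), then feed the ★ facts on `«local»` (definitionally the same types)
  refine exists_isHaarMeasure_compactCore_centralizer_prod_eq_one
    (A := (UnitaryGroup.cmDatum L 2 (Matrix.of fun i j : Fin 2 => if i.val + j.val + 1 = 2 then (1 : L) else 0)).Local v)
    (B := (UnitaryGroup.cmDatum L 1 (Matrix.of fun i j : Fin 1 => if i.val + j.val + 1 = 1 then (1 : L) else 0)).Local v)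
    γ₂ γ₁ ?_ ?_ ?_ ?_ ?_ ?_
  · exact (compactCore_centralizer_local_facts_of_isRegularElt (IsCMField.complexConj L) 2 _ (IsCMField.complexConj_ne_one L) hΦ₂ hΦ₂d γ₂ h₂).1
  · exact (compactCore_centralizer_local_facts_of_isRegularElt (IsCMField.complexConj L) 1 _ (IsCMField.complexConj_ne_one L) hΦ₁ hΦ₁d γ₁ h₁).1
  · exact (compactCore_centralizer_local_facts_of_isRegularElt (IsCMField.complexConj L) 2 _ (IsCMField.complexConj_ne_one L) hΦ₂ hΦ₂d γ₂ h₂).2.1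
  · exact (compactCore_centralizer_local_facts_of_isRegularElt (IsCMField.complexConj L) 2 _ (IsCMField.complexConj_ne_one L) hΦ₂ hΦ₂d γ₂ h₂).2.2
  · exact (compactCore_centralizer_local_facts_of_isRegularElt (IsCMField.complexConj L) 1 _ (IsCMField.complexConj_ne_one L) hΦ₁ hΦ₁d γ₁ h₁).2.1
  · exact (compactCore_centralizer_local_facts_of_isRegularElt (IsCMField.complexConj L) 1 _ (IsCMField.complexConj_ne_one L) hΦ₁ hΦ₁d γ₁ h₁).2.2

variable {T : Subgroup ((UnitaryGroup.cmDatum L 2 (Matrix.of fun i j : Fin 2 => if i.val + j.val + 1 = 2 then (1 : L) else 0)).Local v ×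
      (UnitaryGroup.cmDatum L 1 (Matrix.of fun i j : Fin 1 => if i.val + j.val + 1 = 1 then (1 : L) else 0)).Local v)}
  {γ₀ : (UnitaryGroup.cmDatum L 2 (Matrix.of fun i j : Fin 2 => if i.val + j.val + 1 = 2 then (1 : L) else 0)).Local v ×
      (UnitaryGroup.cmDatum L 1 (Matrix.of fun i j : Fin 1 => if i.val + j.val + 1 = 1 then (1 : L) else 0)).Local v}
  (hγ₀ : IsLocalGRegular L v γ₀)
  (hT : T = Subgroup.centralizer ({γ₀} : Set ((UnitaryGroup.cmDatum L 2 (Matrix.of fun i j : Fin 2 => if i.val + j.val + 1 = 2 then (1 : L) else 0)).Local v ×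
      (UnitaryGroup.cmDatum L 1 (Matrix.of fun i j : Fin 1 => if i.val + j.val + 1 = 1 then (1 : L) else 0)).Local v)))

include hγ₀ hT in
/-- **Every Cartan subgroup `T = Z_H(γ₀)` of `H_v` (`γ₀` `G`-regular, any finite `v`) carries a Haar measure, inversion invariant, with mass `1` on its compact core** (§1 at `γ₀`, read
on `T`).  For `T` compact this is the Haar probability measure — print's «`meas(T) = 1`» normalisation; the `H_v`-twin of ★ (E3) `exists_haar_cartan_compactCore_eq_one`.
[cite: Rogawski1990, §4.3 (4.3.1) p. 43; §1.7 p. 6] -/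
theorem exists_haar_cartanH_compactCore_eq_one
    [MeasurableSpace ((UnitaryGroup.cmDatum L 2 (Matrix.of fun i j : Fin 2 => if i.val + j.val + 1 = 2 then (1 : L) else 0)).Local v ×
      (UnitaryGroup.cmDatum L 1 (Matrix.of fun i j : Fin 1 => if i.val + j.val + 1 = 1 then (1 : L) else 0)).Local v)]
    [BorelSpace ((UnitaryGroup.cmDatum L 2 (Matrix.of fun i j : Fin 2 => if i.val + j.val + 1 = 2 then (1 : L) else 0)).Local v ×
      (UnitaryGroup.cmDatum L 1 (Matrix.of fun i j : Fin 1 => if i.val + j.val + 1 = 1 then (1 : L) else 0)).Local v)] :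
    ∃ tT : Measure ↥T, tT.IsHaarMeasure ∧ tT.IsInvInvariant ∧ tT (compactCore ↥T) = 1 := by
  subst hT
  exact forall_isLocalGRegular_exists_isHaarMeasure_compactCore_centralizer_eq_one γ₀ hγ₀

/-! ## §2 Canonical orbital integrals at `G`-regular elements of a Cartan subgroup of `H_v` are fibre integrals over `H_v ⧸ T` -/

/-- **CANONICAL ORBITAL INTEGRAL AT A `G`-REGULAR `t ∈ T` WITH `Z_H(t) = T` = FIBRE INTEGRAL OF THE CONJUGATION FAMILY** (every finite `v`; `T` any closed subgroup of `H_v`, in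
practice a Cartan `Z_H(γ₀)` — §2′): for `mHv` canonical for the `G`-regular classes (★ `IsCanonical`, the block's `hcanH`), `t_T` THE Haar measure of `T` with `t_T(compactCore T) = 1`,
`t ∈ T` `G`-regular with `Z_H(t) = T` (the binder `hZt`; for a Cartan `T = Z_H(γ₀)` it is ★ (H3b) `centralizer_eq_cartan_of_isLocalGRegular` — §2′) and `φ` measurable:
**`classOrbitalIntegral mHv φ ⟦t⟧ = ∫_{H_v ⧸ T} φ(Φ(q, t)) d(νHv ∕ t_T)(q)`** — ★ `IsCanonical.classOrbitalIntegral_mk_eq_orbitalIntegral'` (the predicate `IsLocalGRegular L v` is a class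
function: `ι_v` is a homomorphism, ★ `isRegularElt_conj_iff`) with the canonical torus measure of `Z_H(t)` (§1), which read on `T = Z_H(t)` IS `t_T` (★ `eq_of_apply_compactCore_eq_one`,
★ `image_compactCore`), then ★ generic `orbitalIntegral_eq_integral_conjFamily_of_centralizer_eq`.  The `U(Φ₃)` case is ★ (E3) `classOrbitalIntegral_mk_eq_integral_conjFamily_cartan`.
[cite: Rogawski1990, §4.3 (4.3.1) p. 43; §12.5 pp. 182–183] [cite: DeitmarEchterhoff2014, Thm. 1.5.3] -/
theorem classOrbitalIntegral_mk_eq_integral_conjFamily_of_centralizer_eq_H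
    [MeasurableSpace ((UnitaryGroup.cmDatum L 2 (Matrix.of fun i j : Fin 2 => if i.val + j.val + 1 = 2 then (1 : L) else 0)).Local v ×
      (UnitaryGroup.cmDatum L 1 (Matrix.of fun i j : Fin 1 => if i.val + j.val + 1 = 1 then (1 : L) else 0)).Local v)]
    [BorelSpace ((UnitaryGroup.cmDatum L 2 (Matrix.of fun i j : Fin 2 => if i.val + j.val + 1 = 2 then (1 : L) else 0)).Local v ×
      (UnitaryGroup.cmDatum L 1 (Matrix.of fun i j : Fin 1 => if i.val + j.val + 1 = 1 then (1 : L) else 0)).Local v)]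
    [∀ γ : (UnitaryGroup.cmDatum L 2 (Matrix.of fun i j : Fin 2 => if i.val + j.val + 1 = 2 then (1 : L) else 0)).Local v ×
        (UnitaryGroup.cmDatum L 1 (Matrix.of fun i j : Fin 1 => if i.val + j.val + 1 = 1 then (1 : L) else 0)).Local v,
      MeasurableSpace (((UnitaryGroup.cmDatum L 2 (Matrix.of fun i j : Fin 2 => if i.val + j.val + 1 = 2 then (1 : L) else 0)).Local v ×
        (UnitaryGroup.cmDatum L 1 (Matrix.of fun i j : Fin 1 => if i.val + j.val + 1 = 1 then (1 : L) else 0)).Local v) ⧸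
        Subgroup.centralizer ({γ} : Set ((UnitaryGroup.cmDatum L 2 (Matrix.of fun i j : Fin 2 => if i.val + j.val + 1 = 2 then (1 : L) else 0)).Local v ×
          (UnitaryGroup.cmDatum L 1 (Matrix.of fun i j : Fin 1 => if i.val + j.val + 1 = 1 then (1 : L) else 0)).Local v)))]
    [∀ γ : (UnitaryGroup.cmDatum L 2 (Matrix.of fun i j : Fin 2 => if i.val + j.val + 1 = 2 then (1 : L) else 0)).Local v ×
        (UnitaryGroup.cmDatum L 1 (Matrix.of fun i j : Fin 1 => if i.val + j.val + 1 = 1 then (1 : L) else 0)).Local v,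
      BorelSpace (((UnitaryGroup.cmDatum L 2 (Matrix.of fun i j : Fin 2 => if i.val + j.val + 1 = 2 then (1 : L) else 0)).Local v ×
        (UnitaryGroup.cmDatum L 1 (Matrix.of fun i j : Fin 1 => if i.val + j.val + 1 = 1 then (1 : L) else 0)).Local v) ⧸
        Subgroup.centralizer ({γ} : Set ((UnitaryGroup.cmDatum L 2 (Matrix.of fun i j : Fin 2 => if i.val + j.val + 1 = 2 then (1 : L) else 0)).Local v ×
          (UnitaryGroup.cmDatum L 1 (Matrix.of fun i j : Fin 1 => if i.val + j.val + 1 = 1 then (1 : L) else 0)).Local v)))]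
    (T : Subgroup ((UnitaryGroup.cmDatum L 2 (Matrix.of fun i j : Fin 2 => if i.val + j.val + 1 = 2 then (1 : L) else 0)).Local v ×
      (UnitaryGroup.cmDatum L 1 (Matrix.of fun i j : Fin 1 => if i.val + j.val + 1 = 1 then (1 : L) else 0)).Local v))
    (hTc : IsClosed (T : Set ((UnitaryGroup.cmDatum L 2 (Matrix.of fun i j : Fin 2 => if i.val + j.val + 1 = 2 then (1 : L) else 0)).Local v ×
      (UnitaryGroup.cmDatum L 1 (Matrix.of fun i j : Fin 1 => if i.val + j.val + 1 = 1 then (1 : L) else 0)).Local v)))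
    [MeasurableSpace (((UnitaryGroup.cmDatum L 2 (Matrix.of fun i j : Fin 2 => if i.val + j.val + 1 = 2 then (1 : L) else 0)).Local v ×
        (UnitaryGroup.cmDatum L 1 (Matrix.of fun i j : Fin 1 => if i.val + j.val + 1 = 1 then (1 : L) else 0)).Local v) ⧸ T)]
    [BorelSpace (((UnitaryGroup.cmDatum L 2 (Matrix.of fun i j : Fin 2 => if i.val + j.val + 1 = 2 then (1 : L) else 0)).Local v ×
        (UnitaryGroup.cmDatum L 1 (Matrix.of fun i j : Fin 1 => if i.val + j.val + 1 = 1 then (1 : L) else 0)).Local v) ⧸ T)]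
    (νHv : Measure ((UnitaryGroup.cmDatum L 2 (Matrix.of fun i j : Fin 2 => if i.val + j.val + 1 = 2 then (1 : L) else 0)).Local v ×
      (UnitaryGroup.cmDatum L 1 (Matrix.of fun i j : Fin 1 => if i.val + j.val + 1 = 1 then (1 : L) else 0)).Local v))
    [νHv.IsHaarMeasure] [νHv.IsMulRightInvariant]
    {mHv : OrbitalMeasureFamily ((UnitaryGroup.cmDatum L 2 (Matrix.of fun i j : Fin 2 => if i.val + j.val + 1 = 2 then (1 : L) else 0)).Local v ×
      (UnitaryGroup.cmDatum L 1 (Matrix.of fun i j : Fin 1 => if i.val + j.val + 1 = 1 then (1 : L) else 0)).Local v)}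
    (hcanH : mHv.IsCanonical (IsLocalGRegular L v) νHv)
    (tT : Measure ↥T) [tT.IsHaarMeasure] [tT.IsInvInvariant] (htT : tT (compactCore ↥T) = 1)
    (Φ : (((UnitaryGroup.cmDatum L 2 (Matrix.of fun i j : Fin 2 => if i.val + j.val + 1 = 2 then (1 : L) else 0)).Local v ×
        (UnitaryGroup.cmDatum L 1 (Matrix.of fun i j : Fin 1 => if i.val + j.val + 1 = 1 then (1 : L) else 0)).Local v) ⧸ T) × ↥T →
      (UnitaryGroup.cmDatum L 2 (Matrix.of fun i j : Fin 2 => if i.val + j.val + 1 = 2 then (1 : L) else 0)).Local v ×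
        (UnitaryGroup.cmDatum L 1 (Matrix.of fun i j : Fin 1 => if i.val + j.val + 1 = 1 then (1 : L) else 0)).Local v)
    (hΦ : ∀ (x : (UnitaryGroup.cmDatum L 2 (Matrix.of fun i j : Fin 2 => if i.val + j.val + 1 = 2 then (1 : L) else 0)).Local v ×
        (UnitaryGroup.cmDatum L 1 (Matrix.of fun i j : Fin 1 => if i.val + j.val + 1 = 1 then (1 : L) else 0)).Local v) (s : ↥T),
      Φ (QuotientGroup.mk x, s) = x * s * x⁻¹)
    (t : ↥T) (ht : IsLocalGRegular L v (t : (UnitaryGroup.cmDatum L 2 (Matrix.of fun i j : Fin 2 => if i.val + j.val + 1 = 2 then (1 : L) else 0)).Local v ×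
        (UnitaryGroup.cmDatum L 1 (Matrix.of fun i j : Fin 1 => if i.val + j.val + 1 = 1 then (1 : L) else 0)).Local v))
    (hZt : Subgroup.centralizer ({(t : (UnitaryGroup.cmDatum L 2 (Matrix.of fun i j : Fin 2 => if i.val + j.val + 1 = 2 then (1 : L) else 0)).Local v ×
        (UnitaryGroup.cmDatum L 1 (Matrix.of fun i j : Fin 1 => if i.val + j.val + 1 = 1 then (1 : L) else 0)).Local v)} :
        Set ((UnitaryGroup.cmDatum L 2 (Matrix.of fun i j : Fin 2 => if i.val + j.val + 1 = 2 then (1 : L) else 0)).Local v ×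
          (UnitaryGroup.cmDatum L 1 (Matrix.of fun i j : Fin 1 => if i.val + j.val + 1 = 1 then (1 : L) else 0)).Local v)) = T)
    (φ : (UnitaryGroup.cmDatum L 2 (Matrix.of fun i j : Fin 2 => if i.val + j.val + 1 = 2 then (1 : L) else 0)).Local v ×
        (UnitaryGroup.cmDatum L 1 (Matrix.of fun i j : Fin 1 => if i.val + j.val + 1 = 1 then (1 : L) else 0)).Local v → ℂ)
    (hφ : Measurable φ) :
    classOrbitalIntegral mHv φ (ConjClasses.mk (t : (UnitaryGroup.cmDatum L 2 (Matrix.of fun i j : Fin 2 => if i.val + j.val + 1 = 2 then (1 : L) else 0)).Local v ×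
        (UnitaryGroup.cmDatum L 1 (Matrix.of fun i j : Fin 1 => if i.val + j.val + 1 = 1 then (1 : L) else 0)).Local v)) =
      ∫ q, φ (Φ (q, t)) ∂(quotientMeasure T tT hTc νHv) := by
  -- `Z_H(t) = T` as the membership transport along `MulEquiv.refl`
  have hZ : ∀ g : (UnitaryGroup.cmDatum L 2 (Matrix.of fun i j : Fin 2 => if i.val + j.val + 1 = 2 then (1 : L) else 0)).Local v ×
        (UnitaryGroup.cmDatum L 1 (Matrix.of fun i j : Fin 1 => if i.val + j.val + 1 = 1 then (1 : L) else 0)).Local v,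
      (MulEquiv.refl _) g ∈ T ↔ g ∈ Subgroup.centralizer ({(t : (UnitaryGroup.cmDatum L 2 (Matrix.of fun i j : Fin 2 => if i.val + j.val + 1 = 2 then (1 : L) else 0)).Local v ×
        (UnitaryGroup.cmDatum L 1 (Matrix.of fun i j : Fin 1 => if i.val + j.val + 1 = 1 then (1 : L) else 0)).Local v)} : Set _) := fun g => by
    rw [MulEquiv.refl_apply, hZt]
  -- the canonical torus measure of `Z_H(t)` (§1 at `t`)
  obtain ⟨tZ, hZhaar, hZinv, hZone⟩ := forall_isLocalGRegular_exists_isHaarMeasure_compactCore_centralizer_eq_one (L := L) (v := v) (t : _) ht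
  haveI := hZhaar
  haveI := hZinv
  -- `tT` is `tZ` read on `T`: both are Haar measures on `T` with mass one on the compact core
  set e := subgroupCongrHomeomorph (MulEquiv.refl _)
    (Subgroup.centralizer ({(t : (UnitaryGroup.cmDatum L 2 (Matrix.of fun i j : Fin 2 => if i.val + j.val + 1 = 2 then (1 : L) else 0)).Local v ×
        (UnitaryGroup.cmDatum L 1 (Matrix.of fun i j : Fin 1 => if i.val + j.val + 1 = 1 then (1 : L) else 0)).Local v)} : Set _)) T hZ
    continuous_id continuous_id with he
  obtain ⟨e', hee'⟩ : ∃ e' : ↥(Subgroup.centralizer ({(t : (UnitaryGroup.cmDatum L 2 (Matrix.of fun i j : Fin 2 => if i.val + j.val + 1 = 2 then (1 : L) else 0)).Local v ×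
        (UnitaryGroup.cmDatum L 1 (Matrix.of fun i j : Fin 1 => if i.val + j.val + 1 = 1 then (1 : L) else 0)).Local v)} : Set _)) ≃ₜ* ↥T,
      (⇑e : _ → ↥T) = ⇑e' :=
    ⟨{ MulEquiv.subgroupCongr hZt with continuous_toFun := e.continuous, continuous_invFun := e.symm.continuous }, rfl⟩
  haveI : LocallyCompactSpace ↥T := hTc.isClosedEmbedding_subtypeVal.locallyCompactSpace
  haveI : SecondCountableTopology ↥T := TopologicalSpace.Subtype.secondCountableTopology _
  haveI : (Measure.map e tZ).IsHaarMeasure := by rw [hee']; exact ContinuousMulEquiv.isHaarMeasure_map tZ e'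
  have htZ : tT = Measure.map e tZ := by
    refine eq_of_apply_compactCore_eq_one tT _ htT ?_
    have hme : MeasurableEmbedding (⇑e') := e'.toHomeomorph.measurableEmbedding
    rw [hee', ← image_compactCore e', hme.map_apply]
    change tZ (e' ⁻¹' (e' '' compactCore _)) = 1
    rwa [e'.injective.preimage_image]
  -- `G`-regularity is a class function on `H_v` (`ι_v` is a homomorphism)
  have hconj : ∀ g x : (UnitaryGroup.cmDatum L 2 (Matrix.of fun i j : Fin 2 => if i.val + j.val + 1 = 2 then (1 : L) else 0)).Local v ×
        (UnitaryGroup.cmDatum L 1 (Matrix.of fun i j : Fin 1 => if i.val + j.val + 1 = 1 then (1 : L) else 0)).Local v,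
      IsLocalGRegular L v g → IsLocalGRegular L v (x * g * x⁻¹) := by
    intro g x hg
    show IsRegularElt ((endoEmbLocal L v (x * g * x⁻¹)).val : GL (Fin 3) (UnitaryGroup.LocalRing L v))
    rw [map_mul, map_mul, map_inv]
    exact (isRegularElt_conj_iff _ _).2 hg
  have hco := hcanH.classOrbitalIntegral_mk_eq_orbitalIntegral' hconj ht tZ hZone φ
  rw [hco]
  exact orbitalIntegral_eq_integral_conjFamily_of_centralizer_eq T hTc νHv tT Φ hΦ t hZ tZ htZ φ hφ

include hγ₀ in
/-- **§2′ THE CARTAN FORM — CANONICAL ORBITAL INTEGRAL AT A `G`-REGULAR `t ∈ T = Z_H(γ₀)` = FIBRE INTEGRAL OF THE CONJUGATION FAMILY** (`γ₀` `G`-regular; closedness of `T` by ★ (H3b)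
`isClosed_cartan`, `Z_H(t) = T` by ★ (H3b) `centralizer_eq_cartan_of_isLocalGRegular`).  This is the head (H5) WIF-H binds — binder for binder the `H_v`-twin of ★ (E3)
`classOrbitalIntegral_mk_eq_integral_conjFamily_cartan`: **`classOrbitalIntegral mHv φ ⟦t⟧ = ∫_{H_v ⧸ T} φ(Φ(q, t)) d(νHv ∕ t_T)(q)`**.
[cite: Rogawski1990, §4.3 (4.3.1) p. 43; §12.5 pp. 182–183] [cite: DeitmarEchterhoff2014, Thm. 1.5.3] -/
theorem classOrbitalIntegral_mk_eq_integral_conjFamily_cartanH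
    [MeasurableSpace ((UnitaryGroup.cmDatum L 2 (Matrix.of fun i j : Fin 2 => if i.val + j.val + 1 = 2 then (1 : L) else 0)).Local v ×
      (UnitaryGroup.cmDatum L 1 (Matrix.of fun i j : Fin 1 => if i.val + j.val + 1 = 1 then (1 : L) else 0)).Local v)]
    [BorelSpace ((UnitaryGroup.cmDatum L 2 (Matrix.of fun i j : Fin 2 => if i.val + j.val + 1 = 2 then (1 : L) else 0)).Local v ×
      (UnitaryGroup.cmDatum L 1 (Matrix.of fun i j : Fin 1 => if i.val + j.val + 1 = 1 then (1 : L) else 0)).Local v)]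
    [∀ γ : (UnitaryGroup.cmDatum L 2 (Matrix.of fun i j : Fin 2 => if i.val + j.val + 1 = 2 then (1 : L) else 0)).Local v ×
        (UnitaryGroup.cmDatum L 1 (Matrix.of fun i j : Fin 1 => if i.val + j.val + 1 = 1 then (1 : L) else 0)).Local v,
      MeasurableSpace (((UnitaryGroup.cmDatum L 2 (Matrix.of fun i j : Fin 2 => if i.val + j.val + 1 = 2 then (1 : L) else 0)).Local v ×
        (UnitaryGroup.cmDatum L 1 (Matrix.of fun i j : Fin 1 => if i.val + j.val + 1 = 1 then (1 : L) else 0)).Local v) ⧸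
        Subgroup.centralizer ({γ} : Set ((UnitaryGroup.cmDatum L 2 (Matrix.of fun i j : Fin 2 => if i.val + j.val + 1 = 2 then (1 : L) else 0)).Local v ×
          (UnitaryGroup.cmDatum L 1 (Matrix.of fun i j : Fin 1 => if i.val + j.val + 1 = 1 then (1 : L) else 0)).Local v)))]
    [∀ γ : (UnitaryGroup.cmDatum L 2 (Matrix.of fun i j : Fin 2 => if i.val + j.val + 1 = 2 then (1 : L) else 0)).Local v ×
        (UnitaryGroup.cmDatum L 1 (Matrix.of fun i j : Fin 1 => if i.val + j.val + 1 = 1 then (1 : L) else 0)).Local v,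
      BorelSpace (((UnitaryGroup.cmDatum L 2 (Matrix.of fun i j : Fin 2 => if i.val + j.val + 1 = 2 then (1 : L) else 0)).Local v ×
        (UnitaryGroup.cmDatum L 1 (Matrix.of fun i j : Fin 1 => if i.val + j.val + 1 = 1 then (1 : L) else 0)).Local v) ⧸
        Subgroup.centralizer ({γ} : Set ((UnitaryGroup.cmDatum L 2 (Matrix.of fun i j : Fin 2 => if i.val + j.val + 1 = 2 then (1 : L) else 0)).Local v ×
          (UnitaryGroup.cmDatum L 1 (Matrix.of fun i j : Fin 1 => if i.val + j.val + 1 = 1 then (1 : L) else 0)).Local v)))]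
    [MeasurableSpace (((UnitaryGroup.cmDatum L 2 (Matrix.of fun i j : Fin 2 => if i.val + j.val + 1 = 2 then (1 : L) else 0)).Local v ×
        (UnitaryGroup.cmDatum L 1 (Matrix.of fun i j : Fin 1 => if i.val + j.val + 1 = 1 then (1 : L) else 0)).Local v) ⧸ T)]
    [BorelSpace (((UnitaryGroup.cmDatum L 2 (Matrix.of fun i j : Fin 2 => if i.val + j.val + 1 = 2 then (1 : L) else 0)).Local v ×
        (UnitaryGroup.cmDatum L 1 (Matrix.of fun i j : Fin 1 => if i.val + j.val + 1 = 1 then (1 : L) else 0)).Local v) ⧸ T)]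
    (νHv : Measure ((UnitaryGroup.cmDatum L 2 (Matrix.of fun i j : Fin 2 => if i.val + j.val + 1 = 2 then (1 : L) else 0)).Local v ×
      (UnitaryGroup.cmDatum L 1 (Matrix.of fun i j : Fin 1 => if i.val + j.val + 1 = 1 then (1 : L) else 0)).Local v))
    [νHv.IsHaarMeasure] [νHv.IsMulRightInvariant]
    {mHv : OrbitalMeasureFamily ((UnitaryGroup.cmDatum L 2 (Matrix.of fun i j : Fin 2 => if i.val + j.val + 1 = 2 then (1 : L) else 0)).Local v ×
      (UnitaryGroup.cmDatum L 1 (Matrix.of fun i j : Fin 1 => if i.val + j.val + 1 = 1 then (1 : L) else 0)).Local v)}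
    (hcanH : mHv.IsCanonical (IsLocalGRegular L v) νHv)
    (tT : Measure ↥T) [tT.IsHaarMeasure] [tT.IsInvInvariant] (htT : tT (compactCore ↥T) = 1)
    (Φ : (((UnitaryGroup.cmDatum L 2 (Matrix.of fun i j : Fin 2 => if i.val + j.val + 1 = 2 then (1 : L) else 0)).Local v ×
        (UnitaryGroup.cmDatum L 1 (Matrix.of fun i j : Fin 1 => if i.val + j.val + 1 = 1 then (1 : L) else 0)).Local v) ⧸ T) × ↥T →
      (UnitaryGroup.cmDatum L 2 (Matrix.of fun i j : Fin 2 => if i.val + j.val + 1 = 2 then (1 : L) else 0)).Local v ×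
        (UnitaryGroup.cmDatum L 1 (Matrix.of fun i j : Fin 1 => if i.val + j.val + 1 = 1 then (1 : L) else 0)).Local v)
    (hΦ : ∀ (x : (UnitaryGroup.cmDatum L 2 (Matrix.of fun i j : Fin 2 => if i.val + j.val + 1 = 2 then (1 : L) else 0)).Local v ×
        (UnitaryGroup.cmDatum L 1 (Matrix.of fun i j : Fin 1 => if i.val + j.val + 1 = 1 then (1 : L) else 0)).Local v) (s : ↥T),
      Φ (QuotientGroup.mk x, s) = x * s * x⁻¹)
    (t : ↥T) (ht : IsLocalGRegular L v (t : (UnitaryGroup.cmDatum L 2 (Matrix.of fun i j : Fin 2 => if i.val + j.val + 1 = 2 then (1 : L) else 0)).Local v ×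
        (UnitaryGroup.cmDatum L 1 (Matrix.of fun i j : Fin 1 => if i.val + j.val + 1 = 1 then (1 : L) else 0)).Local v))
    (φ : (UnitaryGroup.cmDatum L 2 (Matrix.of fun i j : Fin 2 => if i.val + j.val + 1 = 2 then (1 : L) else 0)).Local v ×
        (UnitaryGroup.cmDatum L 1 (Matrix.of fun i j : Fin 1 => if i.val + j.val + 1 = 1 then (1 : L) else 0)).Local v → ℂ)
    (hφ : Measurable φ) :
    classOrbitalIntegral mHv φ (ConjClasses.mk (t : (UnitaryGroup.cmDatum L 2 (Matrix.of fun i j : Fin 2 => if i.val + j.val + 1 = 2 then (1 : L) else 0)).Local v ×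
        (UnitaryGroup.cmDatum L 1 (Matrix.of fun i j : Fin 1 => if i.val + j.val + 1 = 1 then (1 : L) else 0)).Local v)) =
      ∫ q, φ (Φ (q, t)) ∂(quotientMeasure T tT (isClosed_cartan hT) νHv) :=
  classOrbitalIntegral_mk_eq_integral_conjFamily_of_centralizer_eq_H T (isClosed_cartan hT) νHv hcanH tT htT Φ hΦ t ht
    (centralizer_eq_cartan_of_isLocalGRegular hγ₀ hT t ht) φ hφ

end CMH

end Summit.HodgeConjecture.HodgeConjecture.Cruxes.H413.F0P3cStCharTSUpTrOrbInt
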